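import Literature.NumberTheory.EllipticCurves.BinaryQuarticResolventEmbedding
import HarnessLib

/-!
# The fibres of `ψ : PGL₂(ℤ)\V_ℤ → (GL₂(ℤ) × SL₃(ℤ))\W_ℤ`: at most `2 · #{g(x,y) = 1}` preimages
# (the mechanism of Bhargava–Shankar's Prop. 2.16, published version)

Topic `Literature/NumberTheory/EllipticCurves`; sequel to `BinaryQuarticResolventEmbedding.lean`
(`φ(f) = (A₁, B_f)`, doubled Gram matrices `twoA1 = 2A₁`, `gram f = 2B_f`, `SO(A₁, ℤ)`, the
`F_{ℤ,1} × SO(A₁, ℤ)`-equivalence `W1Equiv`, and Theorem 3.7 of the held arXiv text = Thm 2.14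
of the published version, `BinaryQuartic.phiClassEquiv`).

Source: M. Bhargava, A. Shankar, *Binary quartic forms having bounded invariants, and the
boundedness of the average rank of elliptic curves*, Ann. of Math. (2) 181 (2015) 191–242, §2.6
of the published version (held arXiv text `arXiv:1006.1002v2`, §3.3 pp. 15–16 for the objects):
the map `ψ : PGL₂(ℤ)\V_ℤ → (GL₂(ℤ) × SL₃(ℤ))\W_ℤ`, eq. (28), composite of Theorem 2.14 with
`(F_{ℤ,1} × SO(A₁, ℤ))\W_{ℤ,1} → (GL₂(ℤ) × SL₃(ℤ))\W_ℤ`, and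

> **Proposition 2.16.** *An element of `(GL₂(ℤ) × SL₃(ℤ))\W_ℤ` with nonzero discriminant has
> at most `12` preimages in `PGL₂(ℤ)\V_ℤ` under the map `ψ`.*

whose printed proof takes `F_{ℤ,1} × SO(A₁, ℤ)`-inequivalent preimages `(A₁, B_α)` of `w`, notes
that their resolvent cubic forms `g_α = 4·Det(A₁x − B_αy)` are monic and all `GL₂(ℤ)`-equivalent
to the resolvent `g` of `w`, so that each yields a solution of `g(x, y) = 1`, and invokes the
theorems of Delone [Del] and Evertse [Ev] (`g(x,y) = 1` has at most `12` integral solutions for an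
integral binary cubic form `g` of nonzero discriminant).

This file formalises that mechanism, with complete proofs and **one correction**: the assignment
"preimage `↦` solution" is at most *two*-to-one, not injective. Indeed `φ(f) = (A₁, B_f)` and
`φ(−f) = (A₁, −B_f) = (diag(1,−1), 1) · φ(f)` always have the same image under `ψ`
(`act_diag_one_neg_one`, `gram_neg_one_smul`) and the same attached solution, while `f` and `−f`
are in general not `GL₂(ℤ)`-equivalent (`not_gl2zEquiv_neg_x4_add_y4`: `x⁴ + y⁴ ≁ −x⁴ − y⁴`).
What is true (`w1Equiv_or_of_same_row`) is that two preimages with the same solution are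
`F_{ℤ,1} × SO(A₁, ℤ)`-equivalent *up to the sign* `B ↦ −B`; hence the number of preimages is at
most `2 · #{(x, y) ∈ ℤ² : g(x, y) = 1}` (`ncard_classes_fibre_le`, `ncard_gl2zOrbits_fibre_le`),
i.e. at most `24` with Delone–Evertse. (The constant is immaterial for the use of Prop. 2.16 in
the uniformity estimate, eq. (27) of the published version.) No named facts: the Delone–Evertse
bound is not used; all statements take a finite set `T ⊇ {g = 1}` as a parameter.

## Contents (all proved)

* `TernaryPairs.Pair`, `TernaryPairs.act γ₂ γ₃` — `W_ℤ` (doubled) and the action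
  `(A, B) ↦ (γ₃(pA + qB)γ₃ᵀ, γ₃(rA + sB)γ₃ᵀ)` of `(γ₂, γ₃)`, `γ₂ = (p q; r s)`; `act_mul_mul`.
* `TernaryPairs.twoRes P x y = Det(x·2A − y·2B) = 2 g_P(x, y)` (doubled resolvent cubic form);
  `twoRes_act`: `g_{(γ₂,γ₃)P}(x, y) = (det γ₃)² g_P(px − ry, −qx + sy)`; `det_twoA1 = 2` (monic
  resolvents on `W_{ℤ,1}`); `twoRes_eq_two_of_act_fst`: a realization `(γ₂, γ₃)·P ∈ W_{ℤ,1}`,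
  `γ₃ ∈ SL₃(ℤ)`, yields the solution `(p, −q)` of `g_P = 1`.
* `w1Equiv_or_of_act_eq`, `w1Equiv_or_of_same_row` — the dichotomy: same solution ⇒ relative
  position `((1 0; u ±1), g)` with `g ∈ SO(A₁, ℤ)` ⇒ `B'' ~ B'` or `B'' ~ −B'`.
* `fibre P`, `w1Class`, `sol`, `classes_fibre_cover`, `finite_classes_fibre`,
  `ncard_classes_fibre_le` (`≤ 2·#T` classes in the fibre), and through Theorem 3.7 the `V`-side
  count `ncard_gl2zOrbits_fibre_le`: `#{GL₂(ℤ)f : φ(f) ∈ (GL₂(ℤ) × SL₃(ℤ))·P} ≤ 2·#T`.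

## References

* M. Bhargava, A. Shankar, Ann. of Math. (2) 181 (2015) 191–242, §2.6 of the published version
  (eq. (28), Prop. 2.16); arXiv:1006.1002v2 §3.3 pp. 15–16 (`W_R`, the actions, `g = 4 det(AX − BY)`,
  `A₁`, `W_{R,1}`, `F_{R,1}`). [cite: BhargavaShankarAnnals2015, §3.3 pp. 15–16 (arXiv:1006.1002v2 numbering); Prop. 2.16 of the published version]
* B. N. Delone, *Über die Darstellung der Zahlen durch die binären kubischen Formen von negativer
  Diskriminante*, Math. Z. 31 (1930); J.-H. Evertse, *On the representation of integers by binary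
  cubic forms of positive discriminant*, Invent. Math. 73 (1983) — cited by Bhargava–Shankar as
  [Del], [Ev]; not used here.
-/

noncomputable section

open Matrix

namespace Literature.NumberTheory.EllipticCurves

namespace TernaryPairs

/-! ### `W_ℤ`, the action of `GL₂(ℤ) × SL₃(ℤ)`, and the fibres of `ψ` (published Prop. 2.16) -/

/-- `W_ℤ` (doubled): pairs `(2A, 2B)` of doubled Gram matrices of integral ternary quadratic
forms (Bhargava–Shankar, published version §2.6: "the space `W_ℤ` of pairs of integral ternary
quadratic forms"; held arXiv text §3.3 p. 15). [cite: BhargavaShankarAnnals2015, §3.3 p. 15 (the space W_R of pairs of ternary quadratic forms; arXiv:1006.1002v2 numbering)] -/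
abbrev Pair : Type := Matrix (Fin 3) (Fin 3) ℤ × Matrix (Fin 3) (Fin 3) ℤ

/-- The action of `(γ₂, γ₃) ∈ GL₂(ℤ) × SL₃(ℤ)` on `W_ℤ`: `γ₂ = (p q; r s)` acts by
`(A, B) ↦ (pA + qB, rA + sB)` and `γ₃` by `(A, B) ↦ (γ₃Aγ₃ᵀ, γ₃Bγ₃ᵀ)` (Bhargava–Shankar,
published version §2.6: "`g₂ · (A, B) = (pA + qB, rA + sB)`", `SL₃` by change of variables; held
arXiv text §3.3 p. 15), written for doubled Gram matrices and the row-vector convention.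
[cite: BhargavaShankarAnnals2015, §3.3 p. 15 (action of GL₂ × SL₃ on W; arXiv:1006.1002v2 numbering)] -/
def act (γ₂ : Matrix (Fin 2) (Fin 2) ℤ) (γ₃ : Matrix (Fin 3) (Fin 3) ℤ) (P : Pair) : Pair :=
  (γ₃ * (γ₂ 0 0 • P.1 + γ₂ 0 1 • P.2) * γ₃ᵀ, γ₃ * (γ₂ 1 0 • P.1 + γ₂ 1 1 • P.2) * γ₃ᵀ)

/-- Congruence transforms are linear. [folklore] -/
theorem conj_add_smul (γ X Y : Matrix (Fin 3) (Fin 3) ℤ) (a b : ℤ) :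
    γ * (a • X + b • Y) * γᵀ = a • (γ * X * γᵀ) + b • (γ * Y * γᵀ) := by
  rw [Matrix.mul_add, Matrix.add_mul, Matrix.mul_smul, Matrix.smul_mul, Matrix.mul_smul,
    Matrix.smul_mul]

/-- Congruence transforms compose. [folklore] -/
theorem conj_conj (γ γ' X : Matrix (Fin 3) (Fin 3) ℤ) :
    γ * (γ' * X * γ'ᵀ) * γᵀ = γ * γ' * X * (γ * γ')ᵀ := by
  rw [Matrix.transpose_mul]; simp only [Matrix.mul_assoc]

/-- The identity acts trivially. [folklore] -/
@[simp] theorem act_one_one (P : Pair) : act 1 1 P = P := by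
  simp [act]

/-- `act` is a (left) action of `GL₂(ℤ) × SL₃(ℤ)` (indeed of `M₂(ℤ) × M₃(ℤ)`). [folklore] -/
theorem act_mul_mul (γ₂ γ₂' : Matrix (Fin 2) (Fin 2) ℤ) (γ₃ γ₃' : Matrix (Fin 3) (Fin 3) ℤ)
    (P : Pair) : act (γ₂ * γ₂') (γ₃ * γ₃') P = act γ₂ γ₃ (act γ₂' γ₃' P) := by
  simp only [act, Matrix.mul_apply, Fin.sum_univ_two, conj_add_smul, conj_conj, Prod.mk.injEq]
  constructor <;> module

/-- Moving a realization: `act γ₂' γ₃' P = act (γ₂'γ₂⁻¹) (γ₃'γ₃⁻¹) (act γ₂ γ₃ P)` for invertible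
`γ₂`, `γ₃`. [folklore] -/
theorem act_eq_act_rel (P : Pair) {γ₂ γ₂' : Matrix (Fin 2) (Fin 2) ℤ}
    {γ₃ γ₃' : Matrix (Fin 3) (Fin 3) ℤ} (h₂ : IsUnit γ₂.det) (h₃ : IsUnit γ₃.det) :
    act γ₂' γ₃' P = act (γ₂' * γ₂⁻¹) (γ₃' * γ₃⁻¹) (act γ₂ γ₃ P) := by
  rw [← act_mul_mul, Matrix.mul_assoc, Matrix.nonsing_inv_mul γ₂ h₂, Matrix.mul_one,
    Matrix.mul_assoc, Matrix.nonsing_inv_mul γ₃ h₃, Matrix.mul_one]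

/-- Twice the **resolvent binary cubic form** of a pair: `Det(x·2A − y·2B) = 8 Det(Ax − By) =
2 · (4 Det(Ax − By))` (Bhargava–Shankar, published §2.6: the cubic resolvent form `4 Det(Ax − By)`
of `(A, B) ∈ W_ℤ`; held arXiv text §3.3 p. 15: `g(X,Y) = 4·det(AX − BY)`).
[cite: BhargavaShankarAnnals2015, §3.3 p. 15 (g = 4 det(AX − BY); arXiv:1006.1002v2 numbering)] -/
def twoRes (P : Pair) (x y : ℤ) : ℤ :=
  (x • P.1 - y • P.2).det

/-- `twoRes (2A₁, 2B_f) = 2 g_f`, the doubled resolvent cubic of a quartic form. [folklore] -/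
theorem twoRes_gram (f : BinaryQuartic ℤ) (x y : ℤ) :
    twoRes (twoA1, BinaryQuartic.gram f) x y =
      2 * (x ^ 3 + f.c * x ^ 2 * y + (f.b * f.d - 4 * f.a * f.e) * x * y ^ 2
        + (f.a * f.d ^ 2 + f.b ^ 2 * f.e - 4 * f.a * f.c * f.e) * y ^ 3) :=
  BinaryQuartic.det_twoA1_sub_gram f x y

/-- **Transformation of the resolvent cubic form under `GL₂(ℤ) × SL₃(ℤ)`**: for
`γ₂ = (p q; r s)`, `g_{(γ₂,γ₃)·P}(x, y) = (det γ₃)² g_P(px − ry, −qx + sy)` ("the action of `SL₃`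
fixes the binary cubic form `4·det(AX − BY)`", held arXiv text §3.3 p. 15, while `GL₂` acts on it
by a substitution). [cite: BhargavaShankarAnnals2015, §3.3 p. 15 (SL₃ fixes the resolvent cubic form; arXiv:1006.1002v2 numbering)] -/
theorem twoRes_act (γ₂ : Matrix (Fin 2) (Fin 2) ℤ) (γ₃ : Matrix (Fin 3) (Fin 3) ℤ) (P : Pair)
    (x y : ℤ) : twoRes (act γ₂ γ₃ P) x y =
      γ₃.det ^ 2 * twoRes P (x * γ₂ 0 0 - y * γ₂ 1 0) (-(x * γ₂ 0 1) + y * γ₂ 1 1) := by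
  have key : x • (γ₃ * (γ₂ 0 0 • P.1 + γ₂ 0 1 • P.2) * γ₃ᵀ)
      - y • (γ₃ * (γ₂ 1 0 • P.1 + γ₂ 1 1 • P.2) * γ₃ᵀ)
      = γ₃ * ((x * γ₂ 0 0 - y * γ₂ 1 0) • P.1 - (-(x * γ₂ 0 1) + y * γ₂ 1 1) • P.2) * γ₃ᵀ := by
    rw [conj_add_smul, conj_add_smul, Matrix.mul_sub, Matrix.sub_mul, Matrix.mul_smul,
      Matrix.smul_mul, Matrix.mul_smul, Matrix.smul_mul]
    module
  simp only [twoRes, act]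
  rw [key, Matrix.det_mul, Matrix.det_mul, Matrix.det_transpose]
  ring

/-- `Det(2A₁) = 2`: the resolvent cubic of an element of `W_{ℤ,1}` is monic ("`g` is monic because
`det(A₁) = 1/4`", held arXiv text §3.3 p. 16). [cite: BhargavaShankarAnnals2015, §3.3 p. 16 (g monic; arXiv:1006.1002v2 numbering)] -/
theorem det_twoA1 : (twoA1 : Matrix (Fin 3) (Fin 3) ℤ).det = 2 := by
  simp [twoA1, Matrix.det_fin_three]

/-- **The Thue solution attached to a realization** (the mechanism of the proof of Prop. 2.16 of
the published version): if `(γ₂, γ₃) · P` lies in `W_{ℤ,1}` (first component `A₁`) with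
`det γ₃ = 1`, then, as its resolvent cubic `g_P ∘ (p −q; −r s)` is monic, `(p, −q)` solves
`g_P(x, y) = 1`; in doubled form `twoRes P p (−q) = 2`. [cite: BhargavaShankarAnnals2015, §3.3 p. 16 (arXiv:1006.1002v2); proof of Prop. 2.16 of the published version] -/
theorem twoRes_eq_two_of_act_fst {γ₂ : Matrix (Fin 2) (Fin 2) ℤ} {γ₃ : Matrix (Fin 3) (Fin 3) ℤ}
    {P : Pair} (h : (act γ₂ γ₃ P).1 = twoA1) (h₃ : γ₃.det = 1) :
    twoRes P (γ₂ 0 0) (-γ₂ 0 1) = 2 := by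
  have key := twoRes_act γ₂ γ₃ P 1 0
  have lhs : twoRes (act γ₂ γ₃ P) 1 0 = 2 := by
    rw [twoRes, h, one_smul, zero_smul, sub_zero, det_twoA1]
  rw [lhs, h₃] at key
  simpa using key.symm

/-- Equal first rows give a relative position `m = γ₂'γ₂⁻¹` with first row `(1, 0)`. [folklore] -/
theorem rel_row {γ₂ γ₂' : Matrix (Fin 2) (Fin 2) ℤ} (h₂ : IsUnit γ₂.det) (h00 : γ₂' 0 0 = γ₂ 0 0)
    (h01 : γ₂' 0 1 = γ₂ 0 1) : (γ₂' * γ₂⁻¹) 0 0 = 1 ∧ (γ₂' * γ₂⁻¹) 0 1 = 0 := by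
  have e : ∀ j, (γ₂' * γ₂⁻¹) 0 j = (γ₂ * γ₂⁻¹) 0 j := fun j ↦ by
    simp only [Matrix.mul_apply, Fin.sum_univ_two, h00, h01]
  rw [e 0, e 1, Matrix.mul_nonsing_inv γ₂ h₂]
  simp

/-- **The dichotomy**: if `(2A₁, B'') = (m, g) · (2A₁, B')` with `m = (1 0; u ±1)` and
`det g = 1`, then `g ∈ SO(A₁, ℤ)` and `B'' ~ B'` (sign `+`) or `B'' ~ −B'` (sign `−`) under
`F_{ℤ,1} × SO(A₁, ℤ)`. [folklore] -/
theorem w1Equiv_or_of_act_eq {B' B'' : Matrix (Fin 3) (Fin 3) ℤ} {m : Matrix (Fin 2) (Fin 2) ℤ}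
    {g : Matrix (Fin 3) (Fin 3) ℤ} (h : ((twoA1, B'') : Pair) = act m g (twoA1, B'))
    (hm00 : m 0 0 = 1) (hm01 : m 0 1 = 0) (hm : IsUnit m.det) (hg : g.det = 1) :
    W1Equiv B' B'' ∨ W1Equiv (-B') B'' := by
  simp only [act, Prod.mk.injEq, hm00, hm01, one_smul, zero_smul, add_zero] at h
  obtain ⟨hA, hB⟩ := h
  have hgso : g ∈ soA1 := ⟨hg, hA.symm⟩
  have hdet : m.det = m 1 1 := by rw [Matrix.det_fin_two, hm00, hm01]; ring
  rw [conj_add_smul, ← hA] at hB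
  rw [hdet] at hm
  rcases Int.isUnit_iff.mp hm with h1 | h1 <;> rw [h1] at hB
  · exact Or.inl ⟨g, hgso, m 1 0, by rw [hB, one_smul, add_comm]⟩
  · refine Or.inr ⟨g, hgso, m 1 0, ?_⟩
    rw [hB, neg_smul, one_smul, Matrix.mul_neg, Matrix.neg_mul, add_comm]

/-- **Two realizations with the same Thue solution are `F_{ℤ,1} × SO(A₁, ℤ)`-equivalent up to the
sign `B ↦ −B`**: if `(2A₁, B') = (γ₂, γ₃)·P` and `(2A₁, B'') = (γ₂', γ₃')·P` with
`γ₂, γ₂' ∈ GL₂(ℤ)` having the same first row and `γ₃, γ₃' ∈ SL₃(ℤ)`, then `B'' ~ B'` or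
`B'' ~ −B'`. (In the proof of Prop. 2.16 of the published version the second alternative is
overlooked: `φ(f)` and `φ(−f) = (A₁, −B_f)` always lie in the same `GL₂(ℤ) × SL₃(ℤ)`-orbit and
give the same solution of `g(x,y) = 1`, while `f ≁ −f` in general; so the number of preimages is
bounded by *twice* the number of solutions.) [folklore] -/
theorem w1Equiv_or_of_same_row {P : Pair} {B' B'' : Matrix (Fin 3) (Fin 3) ℤ}
    {γ₂ γ₂' : Matrix (Fin 2) (Fin 2) ℤ} {γ₃ γ₃' : Matrix (Fin 3) (Fin 3) ℤ}
    (h' : ((twoA1, B') : Pair) = act γ₂ γ₃ P) (h'' : ((twoA1, B'') : Pair) = act γ₂' γ₃' P)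
    (hu : IsUnit γ₂.det) (hu' : IsUnit γ₂'.det) (h3 : γ₃.det = 1) (h3' : γ₃'.det = 1)
    (h00 : γ₂' 0 0 = γ₂ 0 0) (h01 : γ₂' 0 1 = γ₂ 0 1) :
    W1Equiv B' B'' ∨ W1Equiv (-B') B'' := by
  have hγ₃u : IsUnit γ₃.det := by rw [h3]; exact isUnit_one
  have hrel : ((twoA1, B'') : Pair) = act (γ₂' * γ₂⁻¹) (γ₃' * γ₃⁻¹) (twoA1, B') := by
    rw [h'', act_eq_act_rel P hu hγ₃u, ← h']
  obtain ⟨hm00, hm01⟩ := rel_row hu h00 h01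
  refine w1Equiv_or_of_act_eq hrel hm00 hm01 ?_ ?_
  · rw [Matrix.det_mul]; exact hu'.mul (Matrix.isUnit_nonsing_inv_det_iff.mpr hu)
  · rw [Matrix.det_mul, Matrix.det_nonsing_inv, h3, h3', Ring.inverse_one, one_mul]

/-! ### `φ(f)` and `φ(−f)` have the same image under `ψ` -/

/-- `(2A₁, −2B) = (diag(1, −1), 1) · (2A₁, 2B)`: the pairs `φ(f)` and `φ(−f) = (A₁, −B_f)` always
lie in the same `GL₂(ℤ) × SL₃(ℤ)`-orbit of `W_ℤ`. [folklore] -/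
theorem act_diag_one_neg_one (B : Matrix (Fin 3) (Fin 3) ℤ) :
    act !![1, 0; 0, -1] 1 ((twoA1, B) : Pair) = (twoA1, -B) := by
  simp [act]

/-- `2B_{−f} = −2B_f`. [folklore] -/
theorem gram_neg_one_smul (f : BinaryQuartic ℤ) :
    BinaryQuartic.gram ((-1 : ℤ) • f) = -BinaryQuartic.gram f := by
  ext i j
  fin_cases i <;> fin_cases j <;> simp [BinaryQuartic.gram]

/-- … while `f` and `−f` need not be `GL₂(ℤ)`-equivalent: `x⁴ + y⁴ ≁ −(x⁴ + y⁴)` (a definite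
form takes values of one sign). Hence `ψ` is at least two-to-one over such points, and the
preimage bound of Prop. 2.16 of the published version must carry the factor `2`
(`ncard_classes_fibre_le`). [folklore] -/
theorem not_gl2zEquiv_neg_x4_add_y4 :
    ¬ BinaryQuartic.GL2ZEquiv (⟨1, 0, 0, 0, 1⟩ : BinaryQuartic ℤ)
      ((-1 : ℤ) • (⟨1, 0, 0, 0, 1⟩ : BinaryQuartic ℤ)) := by
  rintro ⟨γ, -, h⟩
  have ha := congrArg BinaryQuartic.a h
  simp only [BinaryQuartic.smul_a, BinaryQuartic.subst] at ha
  nlinarith [sq_nonneg (γ 0 0 ^ 2), sq_nonneg (γ 0 1 ^ 2)]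

/-! ### Counting the fibre: at most `2 · #{g = 1}` classes -/

/-- The elements `2B'` of `W_{ℤ,1}` with `(2A₁, 2B')` in the `GL₂(ℤ) × SL₃(ℤ)`-orbit of `P` — the
fibre of `ψ : PGL₂(ℤ)\V_ℤ → (GL₂(ℤ) × SL₃(ℤ))\W_ℤ` over `[P]`, seen in `W_{ℤ,1}` via Theorem 3.7
(published eq. (28) and Prop. 2.16). [cite: BhargavaShankarAnnals2015, §3.3 p. 16 (arXiv:1006.1002v2); eq. (28) and Prop. 2.16 of the published version] -/
def fibre (P : Pair) : Set (Matrix (Fin 3) (Fin 3) ℤ) :=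
  {B' | ∃ γ₂ : Matrix (Fin 2) (Fin 2) ℤ, ∃ γ₃ : Matrix (Fin 3) (Fin 3) ℤ,
    IsUnit γ₂.det ∧ γ₃.det = 1 ∧ ((twoA1, B') : Pair) = act γ₂ γ₃ P}

/-- The `F_{ℤ,1} × SO(A₁, ℤ)`-class of `B`. [folklore] -/
def w1Class (B : Matrix (Fin 3) (Fin 3) ℤ) : Set (Matrix (Fin 3) (Fin 3) ℤ) :=
  {B' | W1Equiv B B'}

/-- Equivalent elements have equal classes. [folklore] -/
theorem w1Class_eq_of_w1Equiv {B B' : Matrix (Fin 3) (Fin 3) ℤ} (h : W1Equiv B B') :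
    w1Class B' = w1Class B := by
  ext B''
  exact ⟨fun h' ↦ h.trans h', fun h' ↦ h.symm.trans h'⟩

/-- `B ↦ −B` is compatible with `F_{ℤ,1} × SO(A₁, ℤ)`-equivalence. [folklore] -/
theorem W1Equiv.neg {B B' : Matrix (Fin 3) (Fin 3) ℤ} (h : W1Equiv B B') : W1Equiv (-B) (-B') := by
  obtain ⟨σ, hσ, u, rfl⟩ := h
  exact ⟨σ, hσ, -u, by rw [Matrix.mul_neg, Matrix.neg_mul, neg_add, neg_smul]⟩

open Classical in
/-- The Thue solution attached to an element of the fibre (through a chosen realization).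
[folklore] -/
def sol (P : Pair) (B' : Matrix (Fin 3) (Fin 3) ℤ) : ℤ × ℤ :=
  if h : B' ∈ fibre P then (h.choose 0 0, -h.choose 0 1) else 0

/-- The chosen realization behind `sol`. [folklore] -/
theorem sol_spec {P : Pair} {B' : Matrix (Fin 3) (Fin 3) ℤ} (hB' : B' ∈ fibre P) :
    ∃ γ₂ : Matrix (Fin 2) (Fin 2) ℤ, ∃ γ₃ : Matrix (Fin 3) (Fin 3) ℤ, IsUnit γ₂.det ∧ γ₃.det = 1 ∧
      ((twoA1, B') : Pair) = act γ₂ γ₃ P ∧ sol P B' = (γ₂ 0 0, -γ₂ 0 1) := by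
  rw [sol, dif_pos hB']
  exact ⟨hB'.choose, hB'.choose_spec.choose, hB'.choose_spec.choose_spec.1,
    hB'.choose_spec.choose_spec.2.1, hB'.choose_spec.choose_spec.2.2, rfl⟩

/-- The attached pair solves `g_P = 1` (doubled: `twoRes P = 2`). [folklore] -/
theorem twoRes_sol {P : Pair} {B' : Matrix (Fin 3) (Fin 3) ℤ} (hB' : B' ∈ fibre P) :
    twoRes P (sol P B').1 (sol P B').2 = 2 := by
  obtain ⟨γ₂, γ₃, -, h₃, h, hsol⟩ := sol_spec hB'
  rw [hsol]
  exact twoRes_eq_two_of_act_fst (by rw [← h]) h₃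

/-- Elements of the fibre with the same attached solution are equivalent up to sign. [folklore] -/
theorem w1Equiv_or_of_sol_eq {P : Pair} {B' B'' : Matrix (Fin 3) (Fin 3) ℤ} (hB' : B' ∈ fibre P)
    (hB'' : B'' ∈ fibre P) (h : sol P B' = sol P B'') : W1Equiv B' B'' ∨ W1Equiv (-B') B'' := by
  obtain ⟨γ₂, γ₃, hu, h₃, h', hsol'⟩ := sol_spec hB'
  obtain ⟨γ₂', γ₃', hu', h₃', h'', hsol''⟩ := sol_spec hB''
  rw [hsol', hsol'', Prod.mk.injEq, neg_inj] at h
  exact w1Equiv_or_of_same_row h' h'' hu hu' h₃ h₃' h.1.symm h.2.symm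

/-- The classes met by the fibre over `[P]` lie in a finite set of size `≤ 2 · #T`, for any
finite `T` containing the solutions of `g_P = 1`: namely the classes of `± base(v)`, `v ∈ T`.
[folklore] -/
theorem classes_fibre_cover (P : Pair) (T : Finset (ℤ × ℤ))
    (hT : ∀ x y : ℤ, twoRes P x y = 2 → (x, y) ∈ T) :
    ∃ s : Set (Set (Matrix (Fin 3) (Fin 3) ℤ)), s.Finite ∧ w1Class '' fibre P ⊆ s ∧
      s.ncard ≤ 2 * T.card := by
  classical
  -- a base point of the fibre over each solution
  let base : ℤ × ℤ → Matrix (Fin 3) (Fin 3) ℤ := fun v ↦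
    if h : ∃ B' ∈ fibre P, sol P B' = v then h.choose else 0
  have hbase : ∀ B' ∈ fibre P, base (sol P B') ∈ fibre P ∧ sol P (base (sol P B')) = sol P B' := by
    intro B' hB'
    have h : ∃ B'' ∈ fibre P, sol P B'' = sol P B' := ⟨B', hB', rfl⟩
    simp only [base, dif_pos h]
    exact h.choose_spec
  -- the classes in the fibre are among the classes of `± base v`, `v ∈ T`
  let G : (ℤ × ℤ) × Bool → Set (Matrix (Fin 3) (Fin 3) ℤ) := fun vb ↦
    if vb.2 then w1Class (base vb.1) else w1Class (-base vb.1)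
  have hsub : w1Class '' fibre P ⊆ G '' ((↑T : Set (ℤ × ℤ)) ×ˢ (Set.univ : Set Bool)) := by
    rintro _ ⟨B', hB', rfl⟩
    obtain ⟨hbmem, hbsol⟩ := hbase B' hB'
    have hvT : sol P B' ∈ T := hT _ _ (twoRes_sol hB')
    rcases w1Equiv_or_of_sol_eq hbmem hB' hbsol with h | h
    · exact ⟨(sol P B', true), ⟨hvT, Set.mem_univ _⟩, by
        simp only [G, if_true]; exact (w1Class_eq_of_w1Equiv h).symm⟩
    · exact ⟨(sol P B', false), ⟨hvT, Set.mem_univ _⟩, by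
        simp only [G]; exact (w1Class_eq_of_w1Equiv h).symm⟩
  have hfin : ((↑T : Set (ℤ × ℤ)) ×ˢ (Set.univ : Set Bool)).Finite :=
    (T.finite_toSet).prod Set.finite_univ
  refine ⟨_, hfin.image G, hsub, ?_⟩
  calc (G '' ((↑T : Set (ℤ × ℤ)) ×ˢ (Set.univ : Set Bool))).ncard
      ≤ ((↑T : Set (ℤ × ℤ)) ×ˢ (Set.univ : Set Bool)).ncard := Set.ncard_image_le hfin
    _ = 2 * T.card := by
        rw [Set.ncard_prod, Set.ncard_coe_finset, Set.ncard_univ, Nat.card_eq_fintype_card,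
          Fintype.card_bool, mul_comm]

/-- If `g_P = 1` has finitely many solutions, the fibre over `[P]` meets finitely many
`F_{ℤ,1} × SO(A₁, ℤ)`-classes. [folklore] -/
theorem finite_classes_fibre (P : Pair) (T : Finset (ℤ × ℤ))
    (hT : ∀ x y : ℤ, twoRes P x y = 2 → (x, y) ∈ T) : (w1Class '' fibre P).Finite := by
  obtain ⟨s, hs, hsub, -⟩ := classes_fibre_cover P T hT
  exact hs.subset hsub

/-- **The fibres of `ψ` have at most `2 · #{(x,y) ∈ ℤ² : g(x,y) = 1}` elements** (corrected form
of the mechanism of Prop. 2.16 of the published version, "an element of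
`(GL₂(ℤ) × SL₃(ℤ))\W_ℤ` with nonzero discriminant has at most `12` preimages in `PGL₂(ℤ)\V_ℤ`",
there deduced from the theorems of Delone and Evertse that `g(x,y) = 1` has at most `12` integral
solutions for an integral binary cubic form `g` of nonzero discriminant): if `T` contains every
solution of `g_P(x, y) = 1` (doubled: `twoRes P x y = 2`), then the `F_{ℤ,1} × SO(A₁, ℤ)`-classes
met by the fibre over `[P]` number at most `2 · #T`. The factor `2` accounts for `B` and `−B`
(`φ(f)` and `φ(−f)`), which have the same image and the same solution (`w1Equiv_or_of_same_row`).
[cite: BhargavaShankarAnnals2015, §3.3 p. 16 (arXiv:1006.1002v2); Prop. 2.16 of the published version (mechanism, with the bound doubled)] -/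
theorem ncard_classes_fibre_le (P : Pair) (T : Finset (ℤ × ℤ))
    (hT : ∀ x y : ℤ, twoRes P x y = 2 → (x, y) ∈ T) :
    (w1Class '' fibre P).ncard ≤ 2 * T.card := by
  obtain ⟨s, hs, hsub, hcard⟩ := classes_fibre_cover P T hT
  exact (Set.ncard_le_ncard hsub hs).trans hcard

/-- **`V`-side form (through Theorem 3.7)**: the `GL₂(ℤ)`-orbits (= `PGL₂(ℤ)`-orbits) of integral
binary quartic forms `f` with `ψ(f) = [P]`, i.e. `φ(f) = (A₁, B_f)` in the `GL₂(ℤ) × SL₃(ℤ)`-orbit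
of `P`, number at most `2 · #{(x, y) : g_P(x, y) = 1}` — the preimage count of Prop. 2.16 of the
published version, with the bound doubled (see `w1Equiv_or_of_same_row`); with Delone–Evertse
(`≤ 12` solutions for nonzero discriminant) this gives at most `24` preimages.
[cite: BhargavaShankarAnnals2015, §3.3 p. 16 (arXiv:1006.1002v2); Prop. 2.16 of the published version (with the bound doubled)] -/
theorem ncard_gl2zOrbits_fibre_le (P : Pair) (T : Finset (ℤ × ℤ))
    (hT : ∀ x y : ℤ, twoRes P x y = 2 → (x, y) ∈ T) :
    (BinaryQuartic.gl2zOrbit '' {f : BinaryQuartic ℤ | BinaryQuartic.gram f ∈ fibre P}).ncard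
      ≤ 2 * T.card := by
  classical
  -- the class map on orbits: `GL₂(ℤ)f ↦ [φ(f)]`
  let Φ : Set (BinaryQuartic ℤ) → Set (Matrix (Fin 3) (Fin 3) ℤ) := fun O ↦
    {B'' | ∃ f ∈ O, W1Equiv (BinaryQuartic.gram f) B''}
  have hΦ : ∀ f₀ : BinaryQuartic ℤ, Φ (BinaryQuartic.gl2zOrbit f₀) = w1Class (BinaryQuartic.gram f₀) := by
    intro f₀
    ext B''
    simp only [Φ, Set.mem_setOf_eq, w1Class]
    constructor
    · rintro ⟨f, hf, h⟩
      exact (((BinaryQuartic.w1Equiv_gram_iff f₀ f).mpr hf)).trans h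
    · intro h
      exact ⟨f₀, BinaryQuartic.GL2ZEquiv.refl f₀, h⟩
  refine (Set.ncard_le_ncard_of_injOn Φ ?_ ?_ (finite_classes_fibre P T hT)).trans
    (ncard_classes_fibre_le P T hT)
  · rintro _ ⟨f₀, hf₀, rfl⟩
    exact ⟨BinaryQuartic.gram f₀, hf₀, (hΦ f₀).symm⟩
  · rintro _ ⟨f₀, -, rfl⟩ _ ⟨f₁, -, rfl⟩ h
    rw [hΦ, hΦ] at h
    have h01 : W1Equiv (BinaryQuartic.gram f₀) (BinaryQuartic.gram f₁) := by
      have : BinaryQuartic.gram f₁ ∈ w1Class (BinaryQuartic.gram f₁) := W1Equiv.refl _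
      rw [← h] at this
      exact this
    have hequiv := (BinaryQuartic.w1Equiv_gram_iff f₀ f₁).mp h01
    ext g
    exact ⟨fun hg ↦ hequiv.symm.trans hg, fun hg ↦ hequiv.trans hg⟩

end TernaryPairs

end Literature.NumberTheory.EllipticCurves

/-! ### Appendix: the fibre depends only on the `GL₂(ℤ) × SL₃(ℤ)`-orbit -/

namespace Literature.NumberTheory.EllipticCurves.TernaryPairs

/-- Non-vacuity: `2B` lies in the fibre over `[(2A₁, 2B)]` (realization `(1, 1)`). [folklore] -/
theorem mem_fibre_self (B : Matrix (Fin 3) (Fin 3) ℤ) : B ∈ fibre ((twoA1, B) : Pair) :=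
  ⟨1, 1, by simp, Matrix.det_one, (act_one_one _).symm⟩

/-- Realizations compose: the fibre over `[(γ₂, γ₃) · P]` is contained in the fibre over `[P]`,
for any `γ₂ ∈ GL₂(ℤ)`, `γ₃ ∈ SL₃(ℤ)`. [folklore] -/
theorem fibre_act_subset {γ₂ : Matrix (Fin 2) (Fin 2) ℤ} {γ₃ : Matrix (Fin 3) (Fin 3) ℤ}
    (h₂ : IsUnit γ₂.det) (h₃ : γ₃.det = 1) (P : Pair) : fibre (act γ₂ γ₃ P) ⊆ fibre P := by
  rintro B' ⟨γ₂', γ₃', h₂', h₃', h⟩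
  refine ⟨γ₂' * γ₂, γ₃' * γ₃, ?_, ?_, ?_⟩
  · rw [Matrix.det_mul]; exact h₂'.mul h₂
  · rw [Matrix.det_mul, h₃', h₃, one_mul]
  · rw [act_mul_mul]; exact h

/-- **The fibre of `ψ` over `[P]` depends only on the `GL₂(ℤ) × SL₃(ℤ)`-orbit of `P`**:
`fibre ((γ₂, γ₃) · P) = fibre P` for `γ₂ ∈ GL₂(ℤ)`, `γ₃ ∈ SL₃(ℤ)` (so `fibre`, `ncard_classes_fibre_le`
and `ncard_gl2zOrbits_fibre_le` are statements about the element `[P] ∈ (GL₂(ℤ) × SL₃(ℤ))\W_ℤ`, as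
in Prop. 2.16 of the published version). [cite: BhargavaShankarAnnals2015, §3.3 p. 16 (arXiv:1006.1002v2); eq. (28) and Prop. 2.16 of the published version] -/
theorem fibre_act {γ₂ : Matrix (Fin 2) (Fin 2) ℤ} {γ₃ : Matrix (Fin 3) (Fin 3) ℤ}
    (h₂ : IsUnit γ₂.det) (h₃ : γ₃.det = 1) (P : Pair) : fibre (act γ₂ γ₃ P) = fibre P := by
  refine Set.Subset.antisymm (fibre_act_subset h₂ h₃ P) ?_
  rintro B' ⟨γ₂', γ₃', h₂', h₃', h⟩
  have h₃u : IsUnit γ₃.det := by rw [h₃]; exact isUnit_one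
  refine ⟨γ₂' * γ₂⁻¹, γ₃' * γ₃⁻¹, ?_, ?_, ?_⟩
  · rw [Matrix.det_mul]; exact h₂'.mul (Matrix.isUnit_nonsing_inv_det_iff.mpr h₂)
  · rw [Matrix.det_mul, Matrix.det_nonsing_inv, h₃, h₃', Ring.inverse_one, one_mul]
  · rw [← act_eq_act_rel P h₂ h₃u]; exact h

/-- In particular the Thue-solution bound is orbit-invariant: for `Q = (γ₂, γ₃) · P` the classes
met by the fibre over `[Q]` are those over `[P]`. [folklore] -/
theorem ncard_classes_fibre_act {γ₂ : Matrix (Fin 2) (Fin 2) ℤ} {γ₃ : Matrix (Fin 3) (Fin 3) ℤ}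
    (h₂ : IsUnit γ₂.det) (h₃ : γ₃.det = 1) (P : Pair) :
    (w1Class '' fibre (act γ₂ γ₃ P)).ncard = (w1Class '' fibre P).ncard := by
  rw [fibre_act h₂ h₃ P]

end Literature.NumberTheory.EllipticCurves.TernaryPairs
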